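import Summits.ValiantsHypothesis.ValiantsHypothesis.Theorems.TwistedDetRankTdrSuperadditive
import Summits.ValiantsHypothesis.ValiantsHypothesis.Theorems.TwistedDetRankFermionicNormalFormStubCycleCountEqCard
import Summits.ValiantsHypothesis.ValiantsHypothesis.Theorems.TwistedDetRankFermionicNormalFormStubPartialMapTwist

/-!
# Crux `TwistedDetRank.FermionicNormalForm` (stmt-ValiantsHypothesis-6283), line `registered` —
# cone glue for the construction half (B)

Function-level glue of the line's construction stub B (`LocalGeneratorsSmallTdr`: a local
generator of weight `w` on `S_n`, `n ≥ 1`, is a sum of `(n+1)^(w+1)` twisted determinants), all at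
the level of CONE SUMS `σ ↦ Σ_t sgn σ · Π_i E_t (σ i) i` on `S_n`:

* `gmf_eq_of_repr` — the bridge: `g σ = Σ_t sgn σ Π_i E_t(σ i) i` for all `σ` gives
  `Σ_σ C(g σ) Π_i X(σ i, i) = Σ_t det(X ∘ E_t)` (tree `twistedDet_eq_sum_monomial`);
* `cone_pad`, `cone_scale`, `cone_lincomb` — zero padding (`n ≥ 1`), absorbing a scalar into
  column `0`, and linear combinations re-indexed by `finProdFinEquiv`;
* `stub_fixedPointInterpolation` (B3, registered sub-goal) — every `F : ℕ → ℂ` agrees on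
  `{0, …, n}` with a combination of `k ↦ u^k`, `u = 0, …, n` (transposed Vandermonde system,
  `Matrix.det_vandermonde_ne_zero_iff`);
* `count_eq_sum_ind` — `c_j(σ) = Σ_{γ : cycleType γ = {j}} [σ ⊇ γ]` (landed `stub_cycleCountEqCard`);
* `tuple_twist` — one twist per tuple of cycles: `u^{c₁ σ} Π_x [σ ⊇ γ_x] = Π_i E(σ i) i`, by the
  landed `stub_partialMapTwist` on the union of the supports when the cycles are pairwise
  equal-or-disjoint, and the zero twist otherwise (`cycleFactorsFinset_pairwise_disjoint`).

Sources: M. Marcus, H. Minc, Illinois J. Math. 5 (1961); P. Bürgisser, *Completeness and Reduction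
in Algebraic Complexity Theory* (2000), §7.1.  Elementary; no named facts, no definitions.
-/

-- single-conjunct layout: Sub = Summit, duplicated namespace component intended
set_option linter.dupNamespace false

noncomputable section

namespace Summit.ValiantsHypothesis.ValiantsHypothesis.Theorems.TwistedDetRankFermionicNormalForm

open scoped BigOperators

section ConeGlue

open Equiv

/-- Bridge (coefficient form): if `g σ = Σ_t sgn σ Π_i E_t (σ i) i` for every `σ`, then
`Σ_σ C(g σ) Π_i X(σ i, i) = Σ_t det(X ∘ E_t)` (compare coefficients of the permutation monomials;
tree `TwistedDetRankTdrSuperadditive.twistedDet_eq_sum_monomial`). [folklore] -/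
theorem gmf_eq_of_repr {n r : ℕ} (g : Perm (Fin n) → ℂ) (E : Fin r → Matrix (Fin n) (Fin n) ℂ)
    (h : ∀ σ, g σ = ∑ t, ((Perm.sign σ : ℤ) : ℂ) * ∏ i, E t (σ i) i) :
    (∑ σ : Perm (Fin n), MvPolynomial.C (g σ) *
        ∏ i : Fin n, (MvPolynomial.X (σ i, i) : MvPolynomial (Fin n × Fin n) ℂ)) =
      ∑ t, (Matrix.of fun i j => MvPolynomial.C (E t i j) * MvPolynomial.X (i, j)).det := by
  simp_rw [Theorems.TwistedDetRankTdrSuperadditive.twistedDet_eq_sum_monomial]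
  rw [Finset.sum_comm]
  refine Finset.sum_congr rfl fun σ _ => ?_
  rw [Theorems.TwistedDetRankTdrSuperadditive.prod_X_eq_monomial, MvPolynomial.C_mul_monomial, mul_one,
    ← map_sum, ← h σ]

/-- Padding a cone sum with zero twists (`Π_i 0 = 0` as `n ≥ 1`). [folklore] -/
theorem cone_pad {n r N : ℕ} (hn : 1 ≤ n) (hrN : r ≤ N) (E : Fin r → Matrix (Fin n) (Fin n) ℂ) :
    ∃ E' : Fin N → Matrix (Fin n) (Fin n) ℂ, ∀ σ : Perm (Fin n),
      ∑ t, ((Perm.sign σ : ℤ) : ℂ) * ∏ i, E t (σ i) i =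
        ∑ t, ((Perm.sign σ : ℤ) : ℂ) * ∏ i, E' t (σ i) i := by
  obtain ⟨d, rfl⟩ := Nat.exists_eq_add_of_le hrN
  refine ⟨fun t => Fin.addCases E (fun _ => 0) t, fun σ => ?_⟩
  rw [Fin.sum_univ_add]
  simp only [Fin.addCases_left, Fin.addCases_right]
  have h0 : ∀ t : Fin d, ((Perm.sign σ : ℤ) : ℂ) *
      ∏ i, (0 : Matrix (Fin n) (Fin n) ℂ) (σ i) i = 0 := fun t => by
    rw [Finset.prod_eq_zero (Finset.mem_univ (⟨0, hn⟩ : Fin n)) rfl, mul_zero]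
  rw [Finset.sum_eq_zero fun t _ => h0 t, add_zero]

/-- Absorbing a scalar into column `0` of a twist (`n ≥ 1`). [folklore] -/
theorem cone_scale {n : ℕ} (hn : 1 ≤ n) (c : ℂ) (F : Matrix (Fin n) (Fin n) ℂ) :
    ∃ F' : Matrix (Fin n) (Fin n) ℂ, ∀ σ : Perm (Fin n),
      c * ∏ i, F (σ i) i = ∏ i, F' (σ i) i := by
  refine ⟨fun i j => (if j = (⟨0, hn⟩ : Fin n) then c else 1) * F i j, fun σ => ?_⟩
  rw [Finset.prod_mul_distrib, Finset.prod_ite_eq']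
  simp

/-- A linear combination of cone sums of length `B` indexed by `Fin k` is a cone sum of length
`k·B` (scalars absorbed, pairs re-indexed by `finProdFinEquiv`). [folklore] -/
theorem cone_lincomb {n k B : ℕ} (hn : 1 ≤ n) (β : Fin k → ℂ) (h : Fin k → Perm (Fin n) → ℂ)
    (E : Fin k → Fin B → Matrix (Fin n) (Fin n) ℂ)
    (hE : ∀ u σ, h u σ = ∑ t, ((Perm.sign σ : ℤ) : ℂ) * ∏ i, E u t (σ i) i) :
    ∃ E' : Fin (k * B) → Matrix (Fin n) (Fin n) ℂ, ∀ σ : Perm (Fin n),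
      ∑ u, β u * h u σ = ∑ t, ((Perm.sign σ : ℤ) : ℂ) * ∏ i, E' t (σ i) i := by
  choose F hF using fun u t => cone_scale hn (β u) (E u t)
  refine ⟨fun v => F (finProdFinEquiv.symm v).1 (finProdFinEquiv.symm v).2, fun σ => ?_⟩
  calc ∑ u, β u * h u σ
      = ∑ u, ∑ t, ((Perm.sign σ : ℤ) : ℂ) * ∏ i, F u t (σ i) i := by
        refine Finset.sum_congr rfl fun u _ => ?_
        rw [hE, Finset.mul_sum]
        refine Finset.sum_congr rfl fun t _ => ?_
        rw [← hF u t]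
        ring
    _ = ∑ p : Fin k × Fin B, ((Perm.sign σ : ℤ) : ℂ) * ∏ i, F p.1 p.2 (σ i) i :=
        (Fintype.sum_prod_type' fun u t => ((Perm.sign σ : ℤ) : ℂ) * ∏ i, F u t (σ i) i).symm
    _ = ∑ v : Fin (k * B), ((Perm.sign σ : ℤ) : ℂ) *
          ∏ i, F (finProdFinEquiv.symm v).1 (finProdFinEquiv.symm v).2 (σ i) i :=
        (Equiv.sum_comp finProdFinEquiv.symm (fun p : Fin k × Fin B =>
          ((Perm.sign σ : ℤ) : ℂ) * ∏ i, F p.1 p.2 (σ i) i)).symm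

/-- **B3 (registered sub-goal `stub_fixedPointInterpolation`)** — interpolation in the number of fixed points: every `F : ℕ → ℂ` agrees on `{0, …, n}` with a
combination of the exponentials `k ↦ u^k`, `u = 0, …, n` (the transposed Vandermonde system is
invertible, `Matrix.det_vandermonde_ne_zero_iff`). [folklore] -/
theorem stub_fixedPointInterpolation :
    ∀ (n : ℕ) (F : ℕ → ℂ),
      ∃ β : Fin (n + 1) → ℂ, ∀ k : ℕ, k ≤ n → F k = ∑ u : Fin (n + 1), β u * ((u : ℕ) : ℂ) ^ k := by
  intro n F
  set v : Fin (n + 1) → ℂ := fun i => ((i : ℕ) : ℂ) with hv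
  have hinj : Function.Injective v := fun i j hij => by
    have h : ((i : ℕ) : ℂ) = ((j : ℕ) : ℂ) := hij
    exact Fin.ext (by exact_mod_cast h)
  have hdet : (Matrix.vandermonde v).transpose.det ≠ 0 := by
    rw [Matrix.det_transpose]
    exact Matrix.det_vandermonde_ne_zero_iff.2 hinj
  have hunit : IsUnit (Matrix.vandermonde v).transpose :=
    (Matrix.isUnit_iff_isUnit_det _).2 (isUnit_iff_ne_zero.2 hdet)
  obtain ⟨β, hβ⟩ := (Matrix.mulVec_surjective_iff_isUnit.2 hunit) fun j => F j
  refine ⟨β, fun k hk => ?_⟩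
  have hk' := congr_fun hβ ⟨k, Nat.lt_succ_of_le hk⟩
  rw [← hk']
  simp only [Matrix.mulVec, dotProduct, Matrix.transpose_apply, Matrix.vandermonde_apply, hv]
  exact Finset.sum_congr rfl fun u _ => mul_comm _ _

/-- The number of fixed points is at most `n`. -/
theorem card_fix_le {n : ℕ} (σ : Perm (Fin n)) :
    (Finset.univ.filter fun i => σ i = i).card ≤ n :=
  (Finset.card_filter_le _ _).trans (by rw [Finset.card_univ, Fintype.card_fin])

/-- B2a in summation form: `c_j(σ) = Σ_{γ : cycleType γ = {j}} [σ ⊇ γ]` in `ℂ`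
(landed stub `stub_cycleCountEqCard`). [folklore] -/
theorem count_eq_sum_ind {n : ℕ} (j : ℕ) (σ : Perm (Fin n)) :
    ((σ.cycleType.count j : ℕ) : ℂ) =
      ∑ γ : {γ : Perm (Fin n) // γ.cycleType = {j}},
        (if ∀ i ∈ γ.1.support, σ i = γ.1 i then (1 : ℂ) else 0) := by
  rw [stub_cycleCountEqCard n j σ,
    ← Finset.filter_filter, Finset.card_filter, Nat.cast_sum,
    Finset.sum_subtype (Finset.univ.filter fun γ : Perm (Fin n) => γ.cycleType = {j})
      (p := fun γ : Perm (Fin n) => γ.cycleType = {j}) (fun γ => by simp)]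
  exact Finset.sum_congr rfl fun γ _ => by simp only [Nat.cast_ite, Nat.cast_one, Nat.cast_zero]

/-- One twist per TUPLE of cycles: for cycles `γ_x` (`x : ι`), the function
`σ ↦ u^{c₁ σ} · Π_x [σ ⊇ γ_x]` is a single cone element `Π_i E (σ i) i` — by `stub_partialMapTwist`
applied to the union of the supports when the `γ_x` are pairwise equal-or-disjoint, and the zero
twist otherwise (two distinct overlapping cycles are never both cycles of `σ`,
`Equiv.Perm.cycleFactorsFinset_pairwise_disjoint`). [MarcusMinc1961; Burgisser2000 §7.1] -/
theorem tuple_twist {n : ℕ} (hn : 1 ≤ n) (u : ℂ)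
    {ι : Type*} [Fintype ι] (γ : ι → Perm (Fin n)) (hγ : ∀ x, (γ x).IsCycle) :
    ∃ E : Matrix (Fin n) (Fin n) ℂ, ∀ σ : Perm (Fin n),
      u ^ (Finset.univ.filter fun i => σ i = i).card *
          ∏ x, (if ∀ i ∈ (γ x).support, σ i = γ x i then (1 : ℂ) else 0) = ∏ i, E (σ i) i := by
  classical
  by_cases hc : ∀ x y, γ x = γ y ∨ _root_.Disjoint (γ x).support (γ y).support
  · -- consistent tuple: one partial map on the union of the supports
    set S : Finset (Fin n) := Finset.univ.filter fun i => ∃ x, i ∈ (γ x).support with hS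
    set p : Fin n → Fin n := fun i => if h : ∃ x, i ∈ (γ x).support then γ h.choose i else i
      with hp
    have hpS : ∀ i ∈ S, p i ≠ i := by
      intro i hi
      obtain ⟨x, hx⟩ : ∃ x, i ∈ (γ x).support := by simpa [hS] using hi
      have h : ∃ x, i ∈ (γ x).support := ⟨x, hx⟩
      simp only [hp, dif_pos h]
      exact Perm.mem_support.1 h.choose_spec
    obtain ⟨E, hE⟩ := stub_partialMapTwist n u S p hpS
    refine ⟨E, fun σ => ?_⟩
    have key : (∀ x, ∀ i ∈ (γ x).support, σ i = γ x i) ↔ (∀ i ∈ S, σ i = p i) := by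
      simp only [hS, Finset.mem_filter, Finset.mem_univ, true_and]
      constructor
      · rintro h i ⟨x, hx⟩
        have hex : ∃ x, i ∈ (γ x).support := ⟨x, hx⟩
        simp only [hp, dif_pos hex]
        have hx' : i ∈ (γ hex.choose).support := hex.choose_spec
        rcases hc hex.choose x with heq | hdis
        · rw [heq]; exact h x i hx
        · exact absurd (Finset.disjoint_left.1 hdis hx') (not_not.2 hx)
      · intro h x i hx
        have hex : ∃ x, i ∈ (γ x).support := ⟨x, hx⟩
        have hi := h i hex
        simp only [hp, dif_pos hex] at hi
        have hx' : i ∈ (γ hex.choose).support := hex.choose_spec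
        rcases hc hex.choose x with heq | hdis
        · rw [hi, heq]
        · exact absurd (Finset.disjoint_left.1 hdis hx') (not_not.2 hx)
    rw [← hE σ, Finset.prod_boole]
    congr 1
    by_cases h1 : ∀ i ∈ S, σ i = p i
    · rw [if_pos h1, if_pos (by simpa using key.2 h1)]
    · rw [if_neg h1, if_neg (fun h => h1 (key.1 (by simpa using h)))]
  · -- inconsistent tuple: the indicator product vanishes identically
    push Not at hc
    obtain ⟨x, y, hxy, hndis⟩ := hc
    refine ⟨0, fun σ => ?_⟩
    rw [Finset.prod_eq_zero (Finset.mem_univ (⟨0, hn⟩ : Fin n)) rfl]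
    suffices h0 : ∏ x, (if ∀ i ∈ (γ x).support, σ i = γ x i then (1 : ℂ) else 0) = 0 by
      rw [h0, mul_zero]
    by_cases hxσ : ∀ i ∈ (γ x).support, σ i = γ x i
    · refine Finset.prod_eq_zero (Finset.mem_univ y) (if_neg fun hyσ => ?_)
      have hxm : γ x ∈ σ.cycleFactorsFinset :=
        Perm.mem_cycleFactorsFinset_iff.2 ⟨hγ x, fun a ha => (hxσ a ha).symm⟩
      have hym : γ y ∈ σ.cycleFactorsFinset :=
        Perm.mem_cycleFactorsFinset_iff.2 ⟨hγ y, fun a ha => (hyσ a ha).symm⟩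
      exact hndis ((Perm.cycleFactorsFinset_pairwise_disjoint σ hxm hym hxy).disjoint_support)
    · exact Finset.prod_eq_zero (Finset.mem_univ x) (if_neg hxσ)

end ConeGlue

end Summit.ValiantsHypothesis.ValiantsHypothesis.Theorems.TwistedDetRankFermionicNormalForm

end
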